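import Summits.ABC.ABC.Theorems.FeketeScalesSubmultOfRSTBridge
import Summits.ABC.ABC.Theorems.FeketeScalesScaleSubmultiplicativityOfEnvelopeOfPowerShapes

/-!
# Crux `ScaleSubmultiplicativity` (stmt-ABC-2160), line SketchIdeator3: the open stubs modulo RST Conjecture A

Route `FeketeScales` (ABC/ABC).  The lead skeleton of line SketchIdeator3 (card core-lattice-dichotomy,
`Cruxes/ScaleSubmultiplicativity/Lines/SketchIdeator3.lean`) proves the crux from two registered stubs,

* S5 `ScaleSubmultiplicativity.primitive_subpower_envelope` — (P): a sub-power envelope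
  `c ≤ e^B · rad · exp((log rad)^θ)`, `0 ≤ θ < 1`, on the abc triples NOT of power shape;
* S6 `ScaleSubmultiplicativity.powerShape_submult` — (W): the crux's G-free inequality on power-shaped triples,

through the landed transfer `ScaleSubmultiplicativity.of_primitiveEnvelope_of_powerShapeSubmult` (S7).  This file
records, in the accepted tree and with the REGISTERED signatures verbatim, the logical position of the two open stubs:

1. (W) is NECESSARY: `ScaleSubmultiplicativity → (W)` (`powerShape_submult_of_scaleSubmultiplicativity`);
2. (P) follows from the pointwise sub-power slack for all triples (the hypothesis of `SubmultOfRST`), hence both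
   stubs follow from `Literature.Barriers.ABC.RSTConjectureAUpper` (Robert–Stewart–Tenenbaum 2014, Conjecture A,
   upper half) — `primitive_subpower_envelope_of_rstConjectureAUpper`, `powerShape_submult_of_rstConjectureAUpper`;
3. consequently the line's composition is CLOSED MODULO `RSTConjectureAUpper`
   (`ScaleSubmultiplicativity.of_rstConjectureAUpper_via_envelope_of_powerShapes`, a conditional result);
4. (P) is abc-strength: it gives, for every `ε > 0`, `c < C_ε · rad^{1+ε}` on every non-power-shaped triple
   (`ScaleSubmultiplicativity.abc_on_primitive_of_primitive_subpower_envelope`).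

Items 1–2 and 4 are adapted from the standing disprover's workfile `Cruxes/ScaleSubmultiplicativity/Disproof.lean`
§5 (refuter-cdisprove-stmt-ABC-2160-0, 2026-08-16), which is not importable from `Theorems/`.
Sources: [RobertStewartTenenbaum2014, Conjecture A (1.5), §1]; route file docstring of stmt-ABC-2160 / stmt-ABC-10340.
-/

-- `Summit.<Summit>.<Problem>` is the mandated summit-side namespace (CONVENTIONS §2); for the
-- single-conjunct summit `ABC` the two coincide, so the duplicate `ABC.ABC` is deliberate.
set_option linter.dupNamespace false

namespace Summit.ABC.ABC.Theorems

open Literature.NumberTheory.DiophantineGeometry Literature.Barriers.ABC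
open Summit.ABC.ABC.Theses.FeketeScales

/-! ### (W) is necessary -/

/-- **Stub (W) is necessary for the crux.**  `ScaleSubmultiplicativity` implies the registered stub S6
`ScaleSubmultiplicativity.powerShape_submult` (the crux restricted to power-shaped triples, with `0 ≤ θ`):
take `θ⁺ := max θ 0`, the same `K`, and `R₀ ⊔ 4` (so that `R₁R₂ ≥ 3` and the slack is monotone in `θ`,
`ScaleSubmultiplicativity.bound_mono`).  Adapted from `Disproof.stubW_of_scaleSubmultiplicativity`. [folklore] -/
theorem ScaleSubmultiplicativity.powerShape_submult_of_scaleSubmultiplicativity :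
    Summit.ABC.ABC.Theses.FeketeScales.ScaleSubmultiplicativity →
    ∃ θ : ℝ, 0 ≤ θ ∧ θ < 1 ∧ ∃ K : ℝ, 0 < K ∧ ∃ R₀ : ℕ, ∀ R₁ R₂ : ℕ, R₀ ≤ R₁ → R₀ ≤ R₂ →
      ∀ a b c : ℕ, IsABCTriple a b c →
      (∃ j : ℕ, 2 ≤ j ∧ ((∃ x y : ℕ, a = x ^ j ∧ b = y ^ j) ∨ (∃ x z : ℕ, a = x ^ j ∧ c = z ^ j) ∨
          (∃ y z : ℕ, b = y ^ j ∧ c = z ^ j))) →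
      rad a b c ≤ R₁ * R₂ →
      ∃ a₁ b₁ c₁ a₂ b₂ c₂ : ℕ, IsABCTriple a₁ b₁ c₁ ∧ rad a₁ b₁ c₁ ≤ R₁ ∧ IsABCTriple a₂ b₂ c₂ ∧
        rad a₂ b₂ c₂ ≤ R₂ ∧ (c : ℝ) ≤ K * Real.exp (Real.log ((R₁ : ℝ) * R₂) ^ θ) * c₁ * c₂ := by
  rintro ⟨θ, hθ1, K, hK, R₀, hS⟩
  refine ⟨max θ 0, le_max_right _ _, max_lt hθ1 one_pos, K, hK, max R₀ 4, ?_⟩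
  intro R₁ R₂ hR₁ hR₂ a b c habc _hps hrad
  obtain ⟨a₁, b₁, c₁, a₂, b₂, c₂, h₁, hr₁, h₂, hr₂, hle⟩ :=
    hS R₁ R₂ ((le_max_left _ _).trans hR₁) ((le_max_left _ _).trans hR₂) a b c habc hrad
  have hR3 : 3 ≤ R₁ * R₂ :=
    calc 3 ≤ 4 * 4 := by norm_num
      _ ≤ R₁ * R₂ := Nat.mul_le_mul ((le_max_right _ _).trans hR₁) ((le_max_right _ _).trans hR₂)
  exact ⟨a₁, b₁, c₁, a₂, b₂, c₂, h₁, hr₁, h₂, hr₂,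
    ScaleSubmultiplicativity.bound_mono (le_max_left _ _) le_rfl hK.le hR3 hle⟩

/-- **Stub (W) below RST Conjecture A (upper half)**: `RSTConjectureAUpper` implies the registered stub S6,
through the landed bridge `SubmultOfRST.scaleSubmultiplicativity_of_rstConjectureAUpper` and necessity of (W).
[cite: RobertStewartTenenbaum2014, Conjecture A (1.5), §1] -/
theorem ScaleSubmultiplicativity.powerShape_submult_of_rstConjectureAUpper :
    Literature.Barriers.ABC.RSTConjectureAUpper →
    ∃ θ : ℝ, 0 ≤ θ ∧ θ < 1 ∧ ∃ K : ℝ, 0 < K ∧ ∃ R₀ : ℕ, ∀ R₁ R₂ : ℕ, R₀ ≤ R₁ → R₀ ≤ R₂ →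
      ∀ a b c : ℕ, IsABCTriple a b c →
      (∃ j : ℕ, 2 ≤ j ∧ ((∃ x y : ℕ, a = x ^ j ∧ b = y ^ j) ∨ (∃ x z : ℕ, a = x ^ j ∧ c = z ^ j) ∨
          (∃ y z : ℕ, b = y ^ j ∧ c = z ^ j))) →
      rad a b c ≤ R₁ * R₂ →
      ∃ a₁ b₁ c₁ a₂ b₂ c₂ : ℕ, IsABCTriple a₁ b₁ c₁ ∧ rad a₁ b₁ c₁ ≤ R₁ ∧ IsABCTriple a₂ b₂ c₂ ∧
        rad a₂ b₂ c₂ ≤ R₂ ∧ (c : ℝ) ≤ K * Real.exp (Real.log ((R₁ : ℝ) * R₂) ^ θ) * c₁ * c₂ :=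
  fun h => ScaleSubmultiplicativity.powerShape_submult_of_scaleSubmultiplicativity
    (SubmultOfRST.scaleSubmultiplicativity_of_rstConjectureAUpper h)

/-! ### (P) below the pointwise sub-power slack, hence below RST Conjecture A -/

/-- **Stub (P) from the pointwise sub-power slack.**  If for some `τ < 1` and real `A` every abc triple has
`c < rad · exp(A (log rad)^τ)` (the hypothesis of `SubmultOfRST`), then the registered stub S5
`ScaleSubmultiplicativity.primitive_subpower_envelope` holds, with `θ := (1 + max τ 0)/2` and an explicit `B`:
above the threshold `N₀` where `(log rad)^{(1-τ⁺)/2} ≥ |A| max(1,(log 2)^τ)` the slack is at most `(log rad)^θ`,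
below it at most `|A| max(1,(log 2)^τ) (log N₀)^{τ⁺}` (`SubmultOfRST.slack_le`, `SubmultOfRST.exists_threshold`).
The power-shape exclusion is not used.  Adapted from `Disproof.stubP_of_subpowerSlack`. [folklore] -/
theorem ScaleSubmultiplicativity.primitive_subpower_envelope_of_subpowerSlack :
    (∃ τ : ℝ, τ < 1 ∧ ∃ A : ℝ, ∀ a b c : ℕ, IsABCTriple a b c →
      (c : ℝ) < ((rad a b c : ℕ) : ℝ) * Real.exp (A * Real.log ((rad a b c : ℕ) : ℝ) ^ τ)) →
    ∃ θ : ℝ, 0 ≤ θ ∧ θ < 1 ∧ ∃ B : ℝ, ∀ a b c : ℕ, IsABCTriple a b c →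
      ¬ (∃ j : ℕ, 2 ≤ j ∧ ((∃ x y : ℕ, a = x ^ j ∧ b = y ^ j) ∨ (∃ x z : ℕ, a = x ^ j ∧ c = z ^ j) ∨
          (∃ y z : ℕ, b = y ^ j ∧ c = z ^ j))) →
      (c : ℝ) ≤ Real.exp B * (rad a b c : ℝ) * Real.exp (Real.log (rad a b c : ℝ) ^ θ) := by
  rintro ⟨τ, hτ1, A, hA⟩
  set t : ℝ := max τ 0 with ht_def
  have ht0 : 0 ≤ t := le_max_right _ _
  have ht1 : t < 1 := max_lt hτ1 one_pos
  set B : ℝ := |A| * max 1 (Real.log 2 ^ τ) with hB_def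
  set s : ℝ := (1 - t) / 2 with hs_def
  have hs : 0 < s := by rw [hs_def]; linarith
  obtain ⟨N₀, hN₀⟩ := SubmultOfRST.exists_threshold B hs
  set B' : ℝ := max (B * Real.log (N₀ : ℝ) ^ t) 0 with hB'_def
  have hB'0 : 0 ≤ B' := le_max_right _ _
  refine ⟨(1 + t) / 2, by linarith, by linarith, B', ?_⟩
  intro a b c habc _hps
  have hrad2 : (2 : ℝ) ≤ ((rad a b c : ℕ) : ℝ) := by exact_mod_cast SubmultOfRST.two_le_rad habc
  have hrad0 : (0 : ℝ) ≤ ((rad a b c : ℕ) : ℝ) := Nat.cast_nonneg _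
  have hlog0 : 0 ≤ Real.log ((rad a b c : ℕ) : ℝ) := Real.log_nonneg (by linarith)
  have hθ0 : 0 ≤ Real.log ((rad a b c : ℕ) : ℝ) ^ ((1 + t) / 2) := Real.rpow_nonneg hlog0 _
  -- the exponent bound `A (log rad)^τ ≤ B' + (log rad)^θ`
  have hexp : A * Real.log ((rad a b c : ℕ) : ℝ) ^ τ
      ≤ B' + Real.log ((rad a b c : ℕ) : ℝ) ^ ((1 + t) / 2) := by
    rcases le_or_gt N₀ (rad a b c) with hN | hN
    · calc A * Real.log ((rad a b c : ℕ) : ℝ) ^ τ ≤ B * Real.log ((rad a b c : ℕ) : ℝ) ^ t :=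
            SubmultOfRST.slack_le habc le_rfl
        _ ≤ Real.log ((rad a b c : ℕ) : ℝ) ^ s * Real.log ((rad a b c : ℕ) : ℝ) ^ t :=
            mul_le_mul_of_nonneg_right (hN₀ _ hN) (Real.rpow_nonneg hlog0 t)
        _ = Real.log ((rad a b c : ℕ) : ℝ) ^ (s + t) := (Real.rpow_add_of_nonneg hlog0 hs.le ht0).symm
        _ = Real.log ((rad a b c : ℕ) : ℝ) ^ ((1 + t) / 2) := by rw [hs_def]; ring_nf
        _ ≤ B' + Real.log ((rad a b c : ℕ) : ℝ) ^ ((1 + t) / 2) := le_add_of_nonneg_left hB'0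
    · calc A * Real.log ((rad a b c : ℕ) : ℝ) ^ τ ≤ B * Real.log (N₀ : ℝ) ^ t :=
            SubmultOfRST.slack_le habc hN.le
        _ ≤ B' := le_max_left _ _
        _ ≤ B' + Real.log ((rad a b c : ℕ) : ℝ) ^ ((1 + t) / 2) := le_add_of_nonneg_right hθ0
  calc (c : ℝ) ≤ ((rad a b c : ℕ) : ℝ) * Real.exp (A * Real.log ((rad a b c : ℕ) : ℝ) ^ τ) :=
        (hA a b c habc).le
    _ ≤ ((rad a b c : ℕ) : ℝ) * Real.exp (B' + Real.log ((rad a b c : ℕ) : ℝ) ^ ((1 + t) / 2)) :=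
        mul_le_mul_of_nonneg_left (Real.exp_le_exp.mpr hexp) hrad0
    _ = Real.exp B' * ((rad a b c : ℕ) : ℝ) * Real.exp (Real.log ((rad a b c : ℕ) : ℝ) ^ ((1 + t) / 2)) := by
        rw [Real.exp_add]; ring

/-- **Stub (P) below RST Conjecture A (upper half)**: `RSTConjectureAUpper` implies the registered stub S5,
via `SubmultOfRST.subpowerSlack_of_rstConjectureAUpper` (`τ = 1/2`).
[cite: RobertStewartTenenbaum2014, Conjecture A (1.5), §1] -/
theorem ScaleSubmultiplicativity.primitive_subpower_envelope_of_rstConjectureAUpper :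
    Literature.Barriers.ABC.RSTConjectureAUpper →
    ∃ θ : ℝ, 0 ≤ θ ∧ θ < 1 ∧ ∃ B : ℝ, ∀ a b c : ℕ, IsABCTriple a b c →
      ¬ (∃ j : ℕ, 2 ≤ j ∧ ((∃ x y : ℕ, a = x ^ j ∧ b = y ^ j) ∨ (∃ x z : ℕ, a = x ^ j ∧ c = z ^ j) ∨
          (∃ y z : ℕ, b = y ^ j ∧ c = z ^ j))) →
      (c : ℝ) ≤ Real.exp B * (rad a b c : ℝ) * Real.exp (Real.log (rad a b c : ℝ) ^ θ) :=
  fun h => ScaleSubmultiplicativity.primitive_subpower_envelope_of_subpowerSlack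
    (SubmultOfRST.subpowerSlack_of_rstConjectureAUpper h)

/-! ### The line is closed modulo `RSTConjectureAUpper` -/

/-- **Line SketchIdeator3 closed modulo RST Conjecture A (upper half).**  The skeleton's composition — the
landed transfer S7 `ScaleSubmultiplicativity.of_primitiveEnvelope_of_powerShapeSubmult` applied to S5 and S6 —
with both open stubs discharged from `RSTConjectureAUpper`; a CONDITIONAL proof of the crux along the line (the
unconditional stubs S5, S6 remain open).  [cite: RobertStewartTenenbaum2014, Conjecture A (1.5), §1] -/
theorem ScaleSubmultiplicativity.of_rstConjectureAUpper_via_envelope_of_powerShapes :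
    Literature.Barriers.ABC.RSTConjectureAUpper →
    Summit.ABC.ABC.Theses.FeketeScales.ScaleSubmultiplicativity :=
  fun h => ScaleSubmultiplicativity.of_primitiveEnvelope_of_powerShapeSubmult
    (ScaleSubmultiplicativity.primitive_subpower_envelope_of_rstConjectureAUpper h)
    (ScaleSubmultiplicativity.powerShape_submult_of_rstConjectureAUpper h)

/-! ### (P) is abc-strength on the non-power-shaped triples -/

/-- **(P) is abc-strength on the primitive (non-power-shaped) triples.**  The registered stub S5 implies, for
every `ε > 0`, a constant `C > 0` with `c < C · rad^{1+ε}` for every abc triple NOT of power shape: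
`(log rad)^θ ≤ ε log rad` once `(log rad)^{1-θ} ≥ 1/ε`, and `exp((log rad)^θ) ≤ exp((log N₁)^θ)` below that
threshold.  So any proof of S5 proves the abc conjecture on a co-thin set of triples (it contains every known
record family).  Adapted from `Disproof.abcOnPrimitive_of_stubP`. [folklore] -/
theorem ScaleSubmultiplicativity.abc_on_primitive_of_primitive_subpower_envelope :
    (∃ θ : ℝ, 0 ≤ θ ∧ θ < 1 ∧ ∃ B : ℝ, ∀ a b c : ℕ, IsABCTriple a b c →
      ¬ (∃ j : ℕ, 2 ≤ j ∧ ((∃ x y : ℕ, a = x ^ j ∧ b = y ^ j) ∨ (∃ x z : ℕ, a = x ^ j ∧ c = z ^ j) ∨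
          (∃ y z : ℕ, b = y ^ j ∧ c = z ^ j))) →
      (c : ℝ) ≤ Real.exp B * (rad a b c : ℝ) * Real.exp (Real.log (rad a b c : ℝ) ^ θ)) →
    ∀ ε : ℝ, 0 < ε → ∃ C : ℝ, 0 < C ∧ ∀ a b c : ℕ, IsABCTriple a b c →
      ¬ (∃ j : ℕ, 2 ≤ j ∧ ((∃ x y : ℕ, a = x ^ j ∧ b = y ^ j) ∨ (∃ x z : ℕ, a = x ^ j ∧ c = z ^ j) ∨
          (∃ y z : ℕ, b = y ^ j ∧ c = z ^ j))) →
      (c : ℝ) < C * ((rad a b c : ℕ) : ℝ) ^ (1 + ε) := by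
  rintro ⟨θ, hθ0, hθ1, B, hP⟩ ε hε
  have hs : 0 < 1 - θ := by linarith
  obtain ⟨N₀, hN₀⟩ := SubmultOfRST.exists_threshold (1 / ε) hs
  set N₁ : ℕ := max N₀ 2 with hN₁
  have hN₁2 : (2 : ℝ) ≤ (N₁ : ℝ) := by exact_mod_cast le_max_right _ _
  have hlogN₁ : 0 ≤ Real.log (N₁ : ℝ) := Real.log_nonneg (by linarith)
  refine ⟨Real.exp B * (Real.exp (Real.log (N₁ : ℝ) ^ θ) + 1), by positivity, ?_⟩
  intro a b c habc hps
  have hc := hP a b c habc hps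
  have hrad2 : (2 : ℝ) ≤ ((rad a b c : ℕ) : ℝ) := by exact_mod_cast SubmultOfRST.two_le_rad habc
  have hrad0 : (0 : ℝ) < ((rad a b c : ℕ) : ℝ) := by linarith
  have hrad1 : (1 : ℝ) ≤ ((rad a b c : ℕ) : ℝ) := by linarith
  have hlog0 : 0 ≤ Real.log ((rad a b c : ℕ) : ℝ) := Real.log_nonneg hrad1
  have hpow1 : ((rad a b c : ℕ) : ℝ) ≤ ((rad a b c : ℕ) : ℝ) ^ (1 + ε) := by
    calc ((rad a b c : ℕ) : ℝ) = ((rad a b c : ℕ) : ℝ) ^ (1 : ℝ) := (Real.rpow_one _).symm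
      _ ≤ ((rad a b c : ℕ) : ℝ) ^ (1 + ε) := Real.rpow_le_rpow_of_exponent_le hrad1 (by linarith)
  have hpowpos : 0 < ((rad a b c : ℕ) : ℝ) ^ (1 + ε) := Real.rpow_pos_of_pos hrad0 _
  have hEB : 0 < Real.exp B := Real.exp_pos B
  rcases le_or_gt N₁ (rad a b c) with hN | hN
  · -- large radical: `(log rad)^θ ≤ ε log rad`
    have hthr : 1 / ε ≤ Real.log ((rad a b c : ℕ) : ℝ) ^ (1 - θ) := hN₀ _ ((le_max_left _ _).trans hN)
    have hθle : Real.log ((rad a b c : ℕ) : ℝ) ^ θ ≤ ε * Real.log ((rad a b c : ℕ) : ℝ) := by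
      have e1 : ε * Real.log ((rad a b c : ℕ) : ℝ)
          = ε * Real.log ((rad a b c : ℕ) : ℝ) ^ (1 - θ) * Real.log ((rad a b c : ℕ) : ℝ) ^ θ := by
        rw [mul_assoc, ← Real.rpow_add_of_nonneg hlog0 hs.le hθ0]; norm_num
      rw [e1]
      have h1 : (1 : ℝ) ≤ ε * Real.log ((rad a b c : ℕ) : ℝ) ^ (1 - θ) := by
        rw [div_le_iff₀ hε, mul_comm] at hthr; exact hthr
      calc Real.log ((rad a b c : ℕ) : ℝ) ^ θ = 1 * Real.log ((rad a b c : ℕ) : ℝ) ^ θ := (one_mul _).symm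
        _ ≤ ε * Real.log ((rad a b c : ℕ) : ℝ) ^ (1 - θ) * Real.log ((rad a b c : ℕ) : ℝ) ^ θ :=
            mul_le_mul_of_nonneg_right h1 (Real.rpow_nonneg hlog0 _)
    have hexp : Real.exp (Real.log ((rad a b c : ℕ) : ℝ) ^ θ) ≤ ((rad a b c : ℕ) : ℝ) ^ ε := by
      calc Real.exp (Real.log ((rad a b c : ℕ) : ℝ) ^ θ)
            ≤ Real.exp (ε * Real.log ((rad a b c : ℕ) : ℝ)) := Real.exp_le_exp.mpr hθle
        _ = ((rad a b c : ℕ) : ℝ) ^ ε := by rw [Real.rpow_def_of_pos hrad0, mul_comm]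
    calc (c : ℝ) ≤ Real.exp B * ((rad a b c : ℕ) : ℝ) * Real.exp (Real.log ((rad a b c : ℕ) : ℝ) ^ θ) := hc
      _ ≤ Real.exp B * ((rad a b c : ℕ) : ℝ) * ((rad a b c : ℕ) : ℝ) ^ ε :=
          mul_le_mul_of_nonneg_left hexp (by positivity)
      _ = Real.exp B * 1 * ((rad a b c : ℕ) : ℝ) ^ (1 + ε) := by
          rw [Real.rpow_add hrad0, Real.rpow_one]; ring
      _ < Real.exp B * (Real.exp (Real.log (N₁ : ℝ) ^ θ) + 1) * ((rad a b c : ℕ) : ℝ) ^ (1 + ε) := by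
          apply mul_lt_mul_of_pos_right _ hpowpos
          apply mul_lt_mul_of_pos_left _ hEB
          linarith [Real.exp_pos (Real.log (N₁ : ℝ) ^ θ)]
  · -- small radical: `exp((log rad)^θ) ≤ exp((log N₁)^θ)`
    have hradN : ((rad a b c : ℕ) : ℝ) ≤ (N₁ : ℝ) := by exact_mod_cast hN.le
    have hmono : Real.exp (Real.log ((rad a b c : ℕ) : ℝ) ^ θ) ≤ Real.exp (Real.log (N₁ : ℝ) ^ θ) :=
      Real.exp_le_exp.mpr (Real.rpow_le_rpow hlog0 (Real.log_le_log hrad0 hradN) hθ0)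
    calc (c : ℝ) ≤ Real.exp B * ((rad a b c : ℕ) : ℝ) * Real.exp (Real.log ((rad a b c : ℕ) : ℝ) ^ θ) := hc
      _ ≤ Real.exp B * ((rad a b c : ℕ) : ℝ) ^ (1 + ε) * Real.exp (Real.log (N₁ : ℝ) ^ θ) :=
          mul_le_mul (mul_le_mul_of_nonneg_left hpow1 hEB.le) hmono (Real.exp_pos _).le (by positivity)
      _ < Real.exp B * ((rad a b c : ℕ) : ℝ) ^ (1 + ε) * Real.exp (Real.log (N₁ : ℝ) ^ θ)
            + Real.exp B * ((rad a b c : ℕ) : ℝ) ^ (1 + ε) := lt_add_of_pos_right _ (by positivity)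
      _ = Real.exp B * (Real.exp (Real.log (N₁ : ℝ) ^ θ) + 1) * ((rad a b c : ℕ) : ℝ) ^ (1 + ε) := by ring

end Summit.ABC.ABC.Theorems
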